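import Literature.Claims.NS.Nguyen2022
import HarnessLib

/-!
# Solo refutation for claim C75 `Nguyen2022` (cell `ns-claims`, D-0090): the λ → 0 passage of p. 19 is false as printed

Claim: V. T. Nguyen, arXiv:2004.08239 v8 (text of record; v9 retreats), Thm 1.0.1 p. 2, resting on
Thm 3.0.1 p. 17 («E′ = −C₀Z, Z′ ≤ C₁Z³ on [0,T) ⇒ t ↦ ‖u(t)‖²_{H¹} non-increasing»). Skeleton
`Literature.Claims.NS.Nguyen2022` (typist-9, p467749); referee pre-read `claims/Nguyen2022/RETYPE.md`
(ref-4, 2026-08-26T21:02Z). This file (seat `ns-claims-salvage-p4`, prover lane; built because the refuter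
of record was silent for > 50 min before the seat wall) records two kernel facts:

* `not_Step3_LambdaLimit` — **the deciding theorem.** `Step3_LambdaLimit` types the sentence «Passing to the
  limit as λ → 0, one obtains (0 + m/‖∇u(t₁)‖²)/(0 + m/‖∇u(t)‖²) ≤ […]^b» (p. 19, TeX l.1541–1549) with the
  printed `m = λ·C₀b/(2C₁E₁)` of (3.0.6)+(3.0.4). With that `m` the hypothesis (3.0.10) does not depend on
  `λ` at all, so it carries no limit information: the instance `Z₁ = 1, Z = 3, E₁ = 2, E = 1, b = 1,
  C₀ = C₁ = 1` satisfies the hypothesis (`15/13 ≤ 2` for every `λ`) and violates the conclusion (`3 ≤ 2`).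
  (Witness of typist-9's CARD §5 / ref-4's RETYPE §1c, re-derived here in the kernel.)
* `not_Step5_Theorem301_scalar` — Theorem 3.0.1 at the scalar grain the printed proof argues is false:
  `C₀ = C₁ = 1`, `E(t) = 4 − 2t − 2t²`, `Z(t) = 2 + 4t` on `[0, 1/4)` obey `E′ = −C₀Z`, `Z′ = 4 ≤ C₁Z³`,
  `E, Z > 0`, yet `E + Z = 6 + 2t − 2t²` INCREASES (`6 < 6.21875` at `t = 1/8`). (ref-4's pair.)

The charitable λ-constant twin `Step3_LambdaLimit_mConst` is TRUE (`step3_mConst_holds`, p468535, file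
`SoloSalvageNguyen2022.lean`): under that reading the break moves to Step 2, whose `m` is then not the
printed one. The field-level `Step5_Theorem301` (LOAD-BEARING as printed) is not decided here (it needs a
rescaled profile `A(t)·w(x/L(t))` with computed `L²` norms); its scalar shadow above is what pp. 17–19 use.

WHAT THIS IS NOT: not a claim about NS regularity or blow-up; not a claim about any author beyond the typed locator.
-/

set_option linter.dupNamespace false

noncomputable section

namespace Summit.NavierStokesRegularity.NavierStokesRegularity.Theorems.Nguyen2022

open Set
open Literature.Claims.NS.Nguyen2022

/-- **Step 3 of the proof of Thm 3.0.1 is false as printed** (`¬ Step3_LambdaLimit`): with the printed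
λ-proportional `m`, hypothesis (3.0.10) is λ-free; witness `Z₁ = 1, Z = 3, E₁ = 2, E = 1, b = 1,
C₀ = C₁ = 1` (hypothesis `15/13 ≤ 2`, conclusion `3 ≤ 2`).
[cite: Nguyen2022NSGlobalNoForce, proof of Thm 3.0.1 Step 2, «Passing to the limit as λ → 0», p. 19] -/
theorem not_Step3_LambdaLimit : ¬ Step3_LambdaLimit := by
  intro h
  have key := h 1 3 2 1 1 1 1 one_pos (by norm_num) (by norm_num) one_pos one_pos one_pos one_pos ?_
  · norm_num at key
  · intro lam hlam _
    have hden : (0 : ℝ) < lam + lam * (1 * 1 / (2 * 1 * 2)) / 3 := by positivity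
    rw [div_le_iff₀ hden, Real.rpow_one]
    nlinarith

/-- **Theorem 3.0.1 at the scalar grain is false** (`¬ Step5_Theorem301_scalar`): `T = 1/4`,
`C₀ = C₁ = 1`, `E(t) = 4 − 2t − 2t²`, `Z(t) = 2 + 4t` satisfy the scalar laws (3.0.1) on `[0, 1/4)`
while `E + Z` strictly increases there (`(E+Z)(0) = 6 < 6.21875 = (E+Z)(1/8)`).
[cite: Nguyen2022NSGlobalNoForce, Thm 3.0.1 p. 17 and its proof pp. 17–19] -/
theorem not_Step5_Theorem301_scalar : ¬ Step5_Theorem301_scalar := by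
  intro h
  have hlaws : ScalarLaws (1 / 4) 1 1 (fun t => 4 - 2 * t - 2 * (t * t)) (fun t => 2 + 4 * t) := by
    intro t ht
    obtain ⟨ht0, ht1⟩ := ht
    have htt : t * t ≤ t * (1 / 4) := mul_le_mul_of_nonneg_left ht1.le ht0
    refine ⟨?_, ?_, ?_, ?_⟩
    · show (0 : ℝ) < 4 - 2 * t - 2 * (t * t)
      nlinarith
    · show (0 : ℝ) < 2 + 4 * t
      linarith
    · show HasDerivWithinAt (fun t => 4 - 2 * t - 2 * (t * t)) (-1 * (2 + 4 * t)) (Ico 0 (1 / 4)) t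
      have hd := ((hasDerivAt_const t (4 : ℝ)).sub ((hasDerivAt_id' (x := t)).const_mul (2 : ℝ))).sub
        (((hasDerivAt_id' (x := t)).mul (hasDerivAt_id' (x := t))).const_mul (2 : ℝ))
      refine (hd.congr_deriv ?_).hasDerivWithinAt
      ring
    · refine ⟨4 * 1, ?_, ?_⟩
      · show HasDerivWithinAt (fun t => 2 + 4 * t) (4 * 1) (Ico 0 (1 / 4)) t
        exact (((hasDerivAt_id' (x := t)).const_mul (4 : ℝ)).const_add (2 : ℝ)).hasDerivWithinAt
      · show (4 : ℝ) * 1 ≤ 1 * (2 + 4 * t) ^ 3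
        have h2 : (2 : ℝ) ≤ 2 + 4 * t := by linarith
        have h8 : (2 : ℝ) ^ 3 ≤ (2 + 4 * t) ^ 3 := pow_le_pow_left₀ (by norm_num) h2 3
        nlinarith
  have hanti := h (1 / 4) 1 1 _ _ (by norm_num) one_pos one_pos hlaws
  have h0 : (0 : ℝ) ∈ Ico (0 : ℝ) (1 / 4) := by rw [mem_Ico]; norm_num
  have h8 : (1 / 8 : ℝ) ∈ Ico (0 : ℝ) (1 / 4) := by rw [mem_Ico]; norm_num
  have key := hanti h0 h8 (by norm_num)
  norm_num at key

end Summit.NavierStokesRegularity.NavierStokesRegularity.Theorems.Nguyen2022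

end
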